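import Literature.NumberTheory.DiophantineGeometry.XYZConjectureProofs
import Literature.NumberTheory.Sieve.PsiPolylogLowerBound
import HarnessLib

/-!
# Harper's Corollary 1, as printed, implies the finiteness half `κ₀ < ∞` of the xyz conjecture

Topic `NumberTheory/DiophantineGeometry`; second PROOF companion of `XYZConjecture.lean` (the named
fact `XYZUpperHalf`: "there is `κ` such that infinitely many abc triples have `S(a,b,c) < (log c)^κ`",
Harper's theorem). Everything in this file is PROVED; no definition, no named fact.

A. J. Harper, Compositio Math. 152 (2016) [Harper2016], Corollary 1 (§1, proved in §5): "There exists
a large absolute constant `K > 0` such that, for any large `logᴷ x ≤ y ≤ x` (and writing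
`u := (log x)/log y`), `#{(a,b,c) ∈ 𝒮(y)³ : a,b,c ≤ x, a+b=c} = Ψ(x,y)³/(2x) · (1 + O(log(u+1)/log y))`."
`xyzUpperHalf_of_harperCorollaryOne` takes the LOWER HALF of this asymptotic, with the absolute
`O`-constant `C` and the threshold `x₀` made explicit and `K` rounded up to a natural number `K₀`
(all weakenings of the printed statement) —

  `∀ x ≥ x₀, ∀ y ∈ [(log x)^{K₀}, x]:  (1 - C · log(u+1)/log y) · ψ(x,y)³/(2x) ≤ N(x,y)`,

where `ψ(x, y) = #(factoredUpTo (Nat.primesLE ⌊y⌋) x)` is the tree's count of `y`-smooth integers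
`1 ≤ n ≤ x` (`Literature/NumberTheory/Sieve/SmoothNumbersRestrictedPrimes.lean`) and `N(x, y)` the
number of pairs `(a, b)`, `a, b ≥ 1`, `a + b ≤ x`, with `ab(a+b)` `y`-smooth (= Harper's count of
triples) — and PROVES from it the named fact `XYZUpperHalf`, through the two proved layers

* `Literature.NumberTheory.Sieve.card_factoredUpTo_polylog_ge` (de Bruijn: `ψ(x, logᴷ x) ≥ x^{1-2/K}`
  eventually) — so at `y = logᴷ x`, `K = max(K₀ + 1, 13, ⌈2 max(C,1)⌉)`, one has `u + 1 ≤ log x`,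
  `C log(u+1)/log y ≤ max(C,1)/K ≤ 1/2` and `N(x, logᴷ x) ≥ ψ³/(4x) ≥ x^{2-6/K}/4 ≥ x^{3/2}`;
* `XYZ.exponentLE_of_frequently_le_ncard` / `xyzUpperHalf_of_frequently_le_ncard` (Harper's
  footnote: primitive parts and a pigeonhole) — so `κ₀ ≤ K` and `XYZUpperHalf`.

Thus the trust base of `XYZUpperHalf` is reduced, inside the tree, to exactly the displayed
one-sided form of [Harper2016, Cor. 1]; the corollary itself (circle method: Harper's minor-arc
Theorem 1, restriction Theorem 2, Drappeau's major arcs, Hildebrand–Tenenbaum) is NOT vendored.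

## References

* [Harper2016] A. J. Harper, *Minor arcs, mean values, and restriction theory for exponential sums
  over smooth numbers*, Compositio Math. 152 (2016) 1121–1158, Cor. 1 and the remark/footnote after
  it (§1), §5 (arXiv:1408.1662).
* [LagariasSoundararajan2011] J. C. Lagarias, K. Soundararajan, JTNB 23 (2011) 209–234, §1.1.
-/

noncomputable section

open Real Filter Finset Asymptotics
open Literature.NumberTheory.Sieve (factoredUpTo card_factoredUpTo_polylog_ge)

namespace Literature.NumberTheory.DiophantineGeometry

/-- **Harper's Corollary 1 (as printed, lower half) ⟹ the finiteness half of the xyz conjecture.**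
Hypothesis: there are `K₀ : ℕ` and reals `C, x₀` such that for all `x ≥ x₀` and all real `y` with
`(log x)^{K₀} ≤ y ≤ x`,
`(1 - C · log(u+1)/log y) · ψ(x,y)³/(2x) ≤ #{(a,b) : a,b ≥ 1, a+b ≤ x, p ∣ ab(a+b) prime ⟹ p ≤ y}`,
`u = log x/log y` — the lower half of "`#{(a,b,c) ∈ 𝒮(y)³ : a,b,c ≤ x, a+b=c} = Ψ(x,y)³/(2x)(1 +
O(log(u+1)/log y))` for any large `logᴷ x ≤ y ≤ x`" [Harper2016, Cor. 1] with its `O`-constant and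
threshold explicit. Conclusion: `XYZUpperHalf` ("… in particular is finite"). Proof: module docstring.
[cite: Harper2016, Cor. 1 and the remark following it (§1)] -/
theorem xyzUpperHalf_of_harperCorollaryOne
    (h : ∃ (K₀ : ℕ) (C x₀ : ℝ), ∀ (x : ℕ) (y : ℝ), x₀ ≤ x → Real.log x ^ K₀ ≤ y → y ≤ x →
      (1 - C * (Real.log (Real.log x / Real.log y + 1) / Real.log y)) *
          (#(factoredUpTo (Nat.primesLE ⌊y⌋₊) x) : ℝ) ^ 3 / (2 * x) ≤
        ({p : ℕ × ℕ | 0 < p.1 ∧ 0 < p.2 ∧ p.1 + p.2 ≤ x ∧ ∀ q : ℕ, q.Prime →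
          q ∣ p.1 * p.2 * (p.1 + p.2) → (q : ℝ) ≤ y}.ncard : ℝ)) :
    XYZUpperHalf := by
  obtain ⟨K₀, C, x₀, hH⟩ := h
  -- the constants `C' = max(C, 1)` and `K = max(K₀ + 1, 13, ⌈2 C'⌉)`
  set C' : ℝ := max C 1 with hC'
  have hC'1 : 1 ≤ C' := le_max_right _ _
  have hCC' : C ≤ C' := le_max_left _ _
  set K : ℕ := max (max (K₀ + 1) 13) ⌈2 * C'⌉₊ with hK
  have hK₀ : K₀ + 1 ≤ K := (le_max_left _ _).trans (le_max_left _ _)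
  have hK13 : 13 ≤ K := (le_max_right _ _).trans (le_max_left _ _)
  have hKC : 2 * C' ≤ K :=
    (Nat.le_ceil _).trans (by exact_mod_cast (le_max_right _ _ : ⌈2 * C'⌉₊ ≤ K))
  have hKr : (13 : ℝ) ≤ K := by exact_mod_cast hK13
  have hK0 : (0 : ℝ) < K := by linarith
  have hexp : 0 < 1 / 2 - 6 / (K : ℝ) := by
    have : 6 / (K : ℝ) ≤ 6 / 13 := div_le_div_of_nonneg_left (by norm_num) (by norm_num) hKr
    linarith
  refine xyzUpperHalf_of_frequently_le_ncard (K := K) (δ := 1 / 2) (by norm_num) ?_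
  refine Filter.Eventually.frequently ?_
  -- eventual conditions on `x`
  have hcast : Tendsto (fun x : ℕ => (x : ℝ)) atTop atTop := tendsto_natCast_atTop_atTop
  have Tℓ : Tendsto (fun x : ℕ => Real.log x) atTop atTop := Real.tendsto_log_atTop.comp hcast
  have Tℓ₂ : Tendsto (fun x : ℕ => Real.log (Real.log x)) atTop atTop :=
    Real.tendsto_log_atTop.comp Tℓ
  have E0 : ∀ᶠ x : ℕ in atTop, (1 : ℝ) ≤ x := hcast.eventually_ge_atTop 1
  have E1 : ∀ᶠ x : ℕ in atTop, x₀ ≤ x := hcast.eventually_ge_atTop x₀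
  have E2 : ∀ᶠ x : ℕ in atTop, (2 : ℝ) ≤ Real.log x := Tℓ.eventually_ge_atTop 2
  have E3 : ∀ᶠ x : ℕ in atTop, (1 : ℝ) ≤ Real.log (Real.log x) := Tℓ₂.eventually_ge_atTop 1
  have E4 : ∀ᶠ x : ℕ in atTop, Real.log x ^ K ≤ x := by
    have h := ((isLittleO_log_rpow_rpow_atTop (K : ℝ) one_pos).comp_tendsto hcast).bound one_pos
    filter_upwards [h, E2] with x hx h2
    simp only [Function.comp_apply, Real.rpow_natCast, Real.rpow_one, one_mul,
      Real.norm_eq_abs] at hx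
    have hℓ0 : (0 : ℝ) ≤ Real.log x := by linarith
    rwa [abs_of_nonneg (pow_nonneg hℓ0 K), abs_of_nonneg (Nat.cast_nonneg _)] at hx
  have E5 : ∀ᶠ x : ℕ in atTop, (4 : ℝ) ≤ (x : ℝ) ^ (1 / 2 - 6 / (K : ℝ)) :=
    ((tendsto_rpow_atTop hexp).comp hcast).eventually_ge_atTop 4
  have E6 := card_factoredUpTo_polylog_ge (κ := (K : ℝ)) (ε := 1 / (K : ℝ)) (by linarith)
    (by positivity)
  filter_upwards [E0, E1, E2, E3, E4, E5, E6] with x h0 h1 h2 h3 h4 h5 h6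
  -- notation: `ℓ = log x ≥ 2`, `ℓ₂ = log log x ≥ 1`, `y = ℓ^K`
  set ℓ : ℝ := Real.log x with hℓ
  set ℓ₂ : ℝ := Real.log ℓ with hℓ₂
  have hx0 : (0 : ℝ) < x := one_pos.trans_le h0
  have hℓ1 : 1 ≤ ℓ := by linarith
  have hℓ0 : 0 < ℓ := by linarith
  have hℓ₂0 : 0 < ℓ₂ := by linarith
  rw [Real.rpow_natCast] at h6
  set y : ℝ := ℓ ^ K with hy
  have hy0 : 0 < y := pow_pos hℓ0 K
  have hlogy : Real.log y = K * ℓ₂ := by rw [hy, Real.log_pow]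
  have hKℓ₂ : 0 < (K : ℝ) * ℓ₂ := mul_pos hK0 hℓ₂0
  -- Harper's bound at `y = logᴷ x`
  have hyK₀ : ℓ ^ K₀ ≤ y := pow_le_pow_right₀ hℓ1 (by omega)
  have hN := hH x y h1 hyK₀ h4
  -- `ψ(x, y) ≥ x^{1 - 2/K}`
  set ψ : ℝ := (#(factoredUpTo (Nat.primesLE ⌊y⌋₊) x) : ℝ) with hψ
  have hψ : (x : ℝ) ^ (1 - 2 / (K : ℝ)) ≤ ψ := by
    have : (1 : ℝ) - 1 / K - 1 / K = 1 - 2 / K := by ring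
    rwa [this] at h6
  have hψ0 : 0 ≤ ψ := Nat.cast_nonneg _
  -- the relative error `C log(u+1)/log y ≤ C'/K ≤ 1/2`
  set u : ℝ := ℓ / Real.log y with hu
  have hu0 : 0 ≤ u := by rw [hu, hlogy]; positivity
  have hu1 : u + 1 ≤ ℓ := by
    have h2K : (2 : ℝ) ≤ K * ℓ₂ := by nlinarith
    have : u ≤ ℓ / 2 := by
      rw [hu, hlogy]; exact div_le_div_of_nonneg_left hℓ0.le (by norm_num) h2K
    linarith
  have hlu0 : 0 ≤ Real.log (u + 1) := Real.log_nonneg (by linarith)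
  have hlu : Real.log (u + 1) ≤ ℓ₂ := Real.log_le_log (by linarith) hu1
  have ht : C * (Real.log (u + 1) / Real.log y) ≤ 1 / 2 := by
    rw [hlogy]
    have ht0 : 0 ≤ Real.log (u + 1) / (K * ℓ₂) := by positivity
    have ht1 : Real.log (u + 1) / (K * ℓ₂) ≤ 1 / K := by
      rw [div_le_div_iff₀ hKℓ₂ hK0]; nlinarith
    have hC'K : C' * (1 / (K : ℝ)) ≤ 1 / 2 := by
      rw [mul_one_div, div_le_iff₀ hK0]; linarith
    calc C * (Real.log (u + 1) / (K * ℓ₂)) ≤ C' * (Real.log (u + 1) / (K * ℓ₂)) :=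
          mul_le_mul_of_nonneg_right hCC' ht0
      _ ≤ C' * (1 / K) := mul_le_mul_of_nonneg_left ht1 (by linarith)
      _ ≤ 1 / 2 := hC'K
  have hfac : (1 : ℝ) / 2 ≤ 1 - C * (Real.log (u + 1) / Real.log y) := by linarith
  -- `x^{3/2} ≤ ψ³/(4x) ≤ (1 - C t) ψ³/(2x) ≤ N`
  have hx32 : (x : ℝ) ^ (1 + 1 / 2 : ℝ) * 4 ≤ (x : ℝ) ^ (2 - 6 / (K : ℝ)) := by
    have hsplit : (x : ℝ) ^ (2 - 6 / (K : ℝ)) = (x : ℝ) ^ (1 + 1 / 2 : ℝ) * (x : ℝ) ^ (1 / 2 - 6 / (K : ℝ)) := by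
      rw [← Real.rpow_add hx0]; ring_nf
    rw [hsplit]
    exact mul_le_mul_of_nonneg_left h5 (by positivity)
  have hcube : ((x : ℝ) ^ (1 - 2 / (K : ℝ))) ^ 3 = (x : ℝ) ^ (2 - 6 / (K : ℝ)) * x := by
    rw [← Real.rpow_natCast, ← Real.rpow_mul hx0.le, ← Real.rpow_add_one hx0.ne']
    ring_nf
  have hmain : (x : ℝ) ^ (1 + 1 / 2 : ℝ) ≤ 1 / 2 * ψ ^ 3 / (2 * x) := by
    have h1' : (x : ℝ) ^ (1 + 1 / 2 : ℝ) = 1 / 2 * ((x : ℝ) ^ (1 + 1 / 2 : ℝ) * 4 * x) / (2 * x) := by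
      field_simp
      ring
    have h2' : (x : ℝ) ^ (1 + 1 / 2 : ℝ) * 4 * x ≤ ψ ^ 3 := by
      calc (x : ℝ) ^ (1 + 1 / 2 : ℝ) * 4 * x ≤ (x : ℝ) ^ (2 - 6 / (K : ℝ)) * x :=
            mul_le_mul_of_nonneg_right hx32 hx0.le
        _ = ((x : ℝ) ^ (1 - 2 / (K : ℝ))) ^ 3 := hcube.symm
        _ ≤ ψ ^ 3 := pow_le_pow_left₀ (by positivity) hψ 3
    rw [h1']
    exact div_le_div_of_nonneg_right (mul_le_mul_of_nonneg_left h2' (by norm_num))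
      (by positivity)
  have hmid : 1 / 2 * ψ ^ 3 / (2 * x) ≤
      (1 - C * (Real.log (u + 1) / Real.log y)) * ψ ^ 3 / (2 * x) :=
    div_le_div_of_nonneg_right (mul_le_mul_of_nonneg_right hfac (by positivity)) (by positivity)
  exact hmain.trans (hmid.trans hN)

end Literature.NumberTheory.DiophantineGeometry

end
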